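import Summits.SmoothPoincare4.SmoothPoincare4.Theorems.AhHadamardFilling.Negative.SketchLineCircular
import Summits.SmoothPoincare4.SmoothPoincare4.Theorems.InformationMetricHadamardC0AhRecognition

/-!
# Crux `AhHadamardFilling` is the summit: `AhHadamardFilling ↔ SmoothPoincare4`, unconditionally

Negative side of crux `InformationMetricHadamard.AhHadamardFilling` (item stmt-SmoothPoincare4-6014,
continuation lead c4, 2026-08-16). The route's other crux `C0AhRecognition` (item 6015) is now a
tree theorem (`Cruxes.C0AhRecognition.CoreDistanceMorse.C0AhRecognition_of`, line
`core-distance-morse`, 2026-08-16T21:22Z), so the conditional certificate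
`ahHadamardFilling_iff_smoothPoincare4_of_c0AhRecognition` (lead c2, p121624) discharges:

* `ahHadamardFilling_iff_smoothPoincare4` — the crux, as typed, is EQUIVALENT to the summit
  `SmoothPoincare4`. Forward: the route's deciding theorem `Theses.InformationMetricHadamard.closes`
  fed with `C0AhRecognition_of`; backward: the hyperbolic witness `W = ℍ⁵` over `S ≅ S⁴ ⊂ ℝ⁵`
  (`ahHadamardFilling_of_smoothPoincare4`, lead c1, p119273).

Consequences recorded for planners / disprovers (no new mathematics): every line of this crux is
exactly SPC4-hard — a proof of any registered apex (`stub_coreSign`, `stub_coreSaddleDominance`,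
`stub_instantonCollarComponentNpc`) proves the smooth 4-dimensional Poincaré conjecture through
this file, and a refutation of the crux exhibits an exotic 4-sphere (`not_smoothPoincare4_iff`).
Nothing here is used positively; the file only pins the item's status by name.
-/

noncomputable section

namespace Summit.SmoothPoincare4.SmoothPoincare4.Theorems.AhHadamardFilling.Negative

open Summit.SmoothPoincare4.SmoothPoincare4.Theses.InformationMetricHadamard
  (AhHadamardFilling C0AhRecognition)

-- the prescribed namespace `Summit.<P>.<Sub>.…` duplicates `SmoothPoincare4` (P = Sub)
set_option linter.dupNamespace false

/-- **The crux IS the summit.** `AhHadamardFilling ↔ SmoothPoincare4`, with no hypothesis: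
`→` is the route's deciding theorem `closes` applied to the landed recognition crux
`C0AhRecognition_of` (item 6015, proved), `←` is the hyperbolic-space witness
`ahHadamardFilling_of_smoothPoincare4`. [folklore] -/
theorem ahHadamardFilling_iff_smoothPoincare4 : AhHadamardFilling ↔ _root_.SmoothPoincare4 :=
  ahHadamardFilling_iff_smoothPoincare4_of_c0AhRecognition
    Cruxes.C0AhRecognition.CoreDistanceMorse.C0AhRecognition_of

/-- **Refuting the crux is refuting the summit.** `¬ AhHadamardFilling ↔ ¬ SmoothPoincare4`:
a counterexample to the crux (a homotopy 4-sphere that is the `C⁰`-conformal infinity of NO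
Cartan–Hadamard 5-manifold) is exactly an exotic 4-sphere, and conversely. [folklore] -/
theorem not_ahHadamardFilling_iff : ¬ AhHadamardFilling ↔ ¬ _root_.SmoothPoincare4 :=
  not_congr ahHadamardFilling_iff_smoothPoincare4

end Summit.SmoothPoincare4.SmoothPoincare4.Theorems.AhHadamardFilling.Negative

end
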